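import Summits.Ventures.PercRepro.Night2FatXGenericTwelve

/-!
# night-2: no five coplanar points off `K` — a geometric sufficient condition for generic off-points

The genericity hypothesis of `localShadowHall_fat_of_generic` (no three-point line of `V` coplanar with the two
off-points `w₀, x` of the fat closure) follows from two plain conditions on `V = G ∖ K`: no five points of `V` on a
plane, and the line through `w₀, x` has no third point of `V`.  Indeed a three-point line `R` coplanar with `w₀, x`
either contains both (then `R` lies on their line) or misses one of them and then both
(`notMem_of_rkN_le_two_of_notMem`), so that `R ∪ {w₀, x}` is a set of `≥ 5` coplanar points
(`generic_of_planes_le_four`).  Hence **`localShadowHall_fat_of_planes_le_four`**: the (2,1) cell with a fat closure,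
no five coplanar points off `K` and a two-point line through the off-points satisfies the local Hall inequality for
every `|G|`.  Paper `proofs/NIGHT-2-g33.md` §6 (g).
-/

namespace PercRepro.Shadow

open PercRepro.ThmH PercRepro.PerFlat

variable {α : Type*} [DecidableEq α] {M : Matroid α} [M.Finite] {G : Finset α}

/-- **No five coplanar points off `K` and a two-point line through the off-points make them generic.** -/
theorem generic_of_planes_le_four (hG : G ∈ flatsQ M (5 + 1)) (hd : (gr M \ G).card = 2)
    (hs : ∀ e ∈ gr M, ∀ f ∈ gr M, e ≠ f → rkN M {e, f} = 2) {B₀ : Finset α} (hB₀ : B₀ ∈ thinMembers M 5 G)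
    (hm₀ : (G \ clF M B₀).card = 2) (hpl : ∀ P ⊆ G \ coloops M G, rkN M P ≤ 3 → P.card ≤ 4)
    (hline : ∀ R ⊆ G \ coloops M G, rkN M R ≤ 2 → G \ clF M B₀ ⊆ R → R.card ≤ 2) :
    ∀ R ⊆ G \ coloops M G, rkN M R = 2 → 3 ≤ R.card → 4 ≤ rkN M (R ∪ (G \ clF M B₀)) := by
  intro R hR hR2 hR3
  by_contra hlt
  have hle : rkN M (R ∪ (G \ clF M B₀)) ≤ 3 := by omega
  have hd' : (gr M \ G).card ≤ 5 := by omega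
  have hGg : G ⊆ gr M := (mem_flatsQ.1 hG).1
  have hKB₀ : coloops M G ⊆ B₀ := coloops_subset_of_mem_thinMembers hG hd' hB₀
  have hKcl : coloops M G ⊆ clF M B₀ :=
    hKB₀.trans (subset_clF_of_subset_gr ((subset_G_of_mem_thinMembers hB₀).trans hGg))
  have hDV : G \ clF M B₀ ⊆ G \ coloops M G := by
    intro e he
    rw [Finset.mem_sdiff] at he ⊢
    exact ⟨he.1, fun hK => he.2 (hKcl hK)⟩
  have hsub : R ∪ (G \ clF M B₀) ⊆ G \ coloops M G := Finset.union_subset hR hDV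
  have hRG : R ⊆ G := hR.trans Finset.sdiff_subset
  obtain ⟨w₀, x, hne, hD⟩ := Finset.card_eq_two.1 hm₀
  by_cases hDR : G \ clF M B₀ ⊆ R
  · -- both off-points on the line `R`: it is their line, of at most two points
    have := hline R hR (le_of_eq hR2) hDR
    omega
  · -- some off-point is off `R`, hence both are: `R ∪ {w₀, x}` has `≥ 5` coplanar points
    have hex : ∃ v ∈ G \ clF M B₀, v ∉ R := by
      by_contra hcon
      apply hDR
      intro e he
      by_contra h'
      exact hcon ⟨e, he, h'⟩
    obtain ⟨v, hvD, hvR⟩ := hex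
    have hboth : w₀ ∉ R ∧ x ∉ R := by
      rw [hD, Finset.mem_insert, Finset.mem_singleton] at hvD
      rcases hvD with rfl | rfl
      · refine ⟨hvR, ?_⟩
        exact notMem_of_rkN_le_two_of_notMem hs hG hD hRG (le_of_eq hR2) hR3 (Finset.pair_comm _ _) hvR
      · refine ⟨?_, hvR⟩
        exact notMem_of_rkN_le_two_of_notMem hs hG hD hRG (le_of_eq hR2) hR3 rfl hvR
    have hdisj : Disjoint R (G \ clF M B₀) := by
      rw [Finset.disjoint_left]
      intro e heR heD
      rw [hD, Finset.mem_insert, Finset.mem_singleton] at heD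
      rcases heD with rfl | rfl
      · exact hboth.1 heR
      · exact hboth.2 heR
    have hcard := hpl _ hsub hle
    rw [Finset.card_union_of_disjoint hdisj, hm₀] at hcard
    omega

/-- **The (2,1) cell with a fat closure, no five coplanar points off `K` and a two-point line through the two
off-points satisfies the local Hall inequality for every `|G|`.** -/
theorem localShadowHall_fat_of_planes_le_four (hG : G ∈ flatsQ M (5 + 1)) (hd : (gr M \ G).card = 2)
    (hk : kColoops M G = 1) (hs : ∀ e ∈ gr M, ∀ f ∈ gr M, e ≠ f → rkN M {e, f} = 2)
    (hl : ∀ e ∈ gr M, M.Indep {e}) (hfat : (fatClosures M 5 G 2).card ≤ 1)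
    {B₀ : Finset α} (hB₀ : B₀ ∈ thinMembers M 5 G) (hm₀ : (G \ clF M B₀).card = 2)
    (hpl : ∀ P ⊆ G \ coloops M G, rkN M P ≤ 3 → P.card ≤ 4)
    (hline : ∀ R ⊆ G \ coloops M G, rkN M R ≤ 2 → G \ clF M B₀ ⊆ R → R.card ≤ 2) :
    LocalShadowHall M 5 G :=
  localShadowHall_fat_of_generic hG hd hk hs hl hfat hB₀ hm₀
    (generic_of_planes_le_four hG hd hs hB₀ hm₀ hpl hline)

end PercRepro.Shadow
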